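import Literature.Barriers.CriticalPhenomena.KozmaNitzanDirectedCounterexample
import HarnessLib

/-!
# `NoHeavyLowerTail` (stmt-CriticalPhenomena-4575) — the DIRECTED analogue of the ONE-CUT sharp form is FALSE
# (proof-shape barrier: a proof of the one-cut engine must use the symmetry of `↔`)

Support / proof-shape file (literature seat `prim-cplus-literature` gen 28; census verdict ttrl2/cp-lit3,
`run/shared/lean/ttrl/dircut/README.md`; memo `run/shared/lean/prim/prim-cplus-literature/DIRECTED-ANALOGUES.md`).
Landed `--supports stmt-CriticalPhenomena-4575` by prover `prim-ineq-gen-5` gen 23 (evidence #2477 on the item, verbatim).  No named facts,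
no sorries, no conjectures; standard axioms.

The ONE-CUT sharp form (the `|A|`-uniform engine of the crux; hypothesis of
`Theorems.noHeavyLowerTail_of_oneCut`): for every finite weighted graph, relays `A`, observer `o`, `t ≥ 0` with
`P(a ↮ a') ≤ t` for all distinct `a, a' ∈ A`:  `P(1 ≤ N ∧ N < (Σ_a P(o ↔ a))/2) ≤ t`, `N = #{a ∈ A : o ↔ a}`.
Its DIRECTED analogue (finite digraph: arcs `Fin m`, endpoints `src tgt`, independent arcs of weights `w`, law
`prodBernoulli w`; directed connection `→` = `DirectedPercolation.openDConn` of the barrier file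
`Literature/Barriers/CriticalPhenomena/KozmaNitzanDirectedCounterexample.lean`; `t` bounds `P(a ↛ a')` for all
ORDERED pairs) is FALSE.  Counterexample (ttrl2 cp-lit3, reduced closed form; Kozma–Nitzan's sure-back-arc
mechanism at `|A| = 3` on four vertices): `o = 0`, `A = {a₁, a₂, a₃} = {1, 2, 3}`; arcs `o → a₁`, `o → a₂` of
weight `q = 4/5`; `a₁ → a₃`, `a₂ → a₃` of weight `r = 9/10`; weight-one arcs `a₁ → o`, `a₂ → o`, `a₃ → a₁`,
`a₃ → a₂`.  Then `P(aᵢ ↛ a₃) = (1−r)(1−qr) = 7/250` (the maximum over ordered pairs; `P(a₁ ↛ a₂) = 1/50`,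
`P(a₃ ↛ aᵢ) = 0`), `Σ_a P(o → a) > 2`, and `N = 1` exactly when one `o → aᵢ` is open with `aᵢ → a₃` and the other
`o → aⱼ` closed, so `P(1 ≤ N < Σ/2) ≥ P(N = 1) = 2q(1−q)(1−r) = 4/125 = 8/250 > 7/250`.

Only LOWER bounds on connection probabilities are needed (sub-events given by explicit open paths), plus the
closure principle `DirectedPercolation.mem_of_closed` to certify `N = 1` on the two witnessing cylinders.

* `DirectedOneCutCex.src/tgt/w` — the digraph (8 arcs on `Fin 4`).
* `DirectedOneCutCex.compl_le` — `P(a ↛ a') ≤ 7/250` for all six ordered pairs of relays.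
* `DirectedOneCutCex.lowerTail_ge` — `4/125 ≤ P(1 ≤ N ∧ N < Σ/2)`.
* `not_directedOneCut` — the negation of the directed analogue of the typed one-cut sharp form.
-/

noncomputable section

namespace Summit.CriticalPhenomena.PercolationContinuityZ3.Theorems

open MeasureTheory Set Literature.Probability.LatticeModels
open Literature.Barriers.CriticalPhenomena Literature.Barriers.CriticalPhenomena.DirectedPercolation
open scoped Classical

namespace DirectedOneCutCex

/-- Tails of the eight arcs: `e₀ : 0 → 1`, `e₁ : 0 → 2`, `e₂ : 1 → 3`, `e₃ : 2 → 3`, `e₄ : 1 → 0`, `e₅ : 2 → 0`,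
`e₆ : 3 → 1`, `e₇ : 3 → 2`. -/
def src : Fin 8 → Fin 4 := ![0, 0, 1, 2, 1, 2, 3, 3]

/-- Heads of the eight arcs. -/
def tgt : Fin 8 → Fin 4 := ![1, 2, 3, 3, 0, 0, 1, 2]

/-- `4/5 ∈ [0,1]`. -/
def q45 : unitInterval := ⟨4 / 5, by norm_num, by norm_num⟩

/-- `9/10 ∈ [0,1]`. -/
def r910 : unitInterval := ⟨9 / 10, by norm_num, by norm_num⟩

/-- Weights: `q = 4/5` on `e₀, e₁`; `r = 9/10` on `e₂, e₃`; `1` on the back arcs `e₄, e₅` and on `e₆, e₇`. -/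
def w : Fin 8 → unitInterval := ![q45, q45, r910, r910, 1, 1, 1, 1]

/-- The relays `A = {1, 2, 3}`. -/
def relays : Finset (Fin 4) := {1, 2, 3}

/-- The values of `src` (tails of the eight arcs). -/
@[simp] private theorem src_vals :
    src 0 = 0 ∧ src 1 = 0 ∧ src 2 = 1 ∧ src 3 = 2 ∧ src 4 = 1 ∧ src 5 = 2 ∧ src 6 = 3 ∧ src 7 = 3 :=
  ⟨rfl, rfl, rfl, rfl, rfl, rfl, rfl, rfl⟩

/-- The values of `tgt` (heads of the eight arcs). -/
@[simp] private theorem tgt_vals :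
    tgt 0 = 1 ∧ tgt 1 = 2 ∧ tgt 2 = 3 ∧ tgt 3 = 3 ∧ tgt 4 = 0 ∧ tgt 5 = 0 ∧ tgt 6 = 1 ∧ tgt 7 = 2 :=
  ⟨rfl, rfl, rfl, rfl, rfl, rfl, rfl, rfl⟩

/-- The eight arc weights as real numbers. -/
@[simp] private theorem w_vals :
    (w 0 : ℝ) = 4 / 5 ∧ (w 1 : ℝ) = 4 / 5 ∧ (w 2 : ℝ) = 9 / 10 ∧ (w 3 : ℝ) = 9 / 10 ∧
      (w 4 : ℝ) = 1 ∧ (w 5 : ℝ) = 1 ∧ (w 6 : ℝ) = 1 ∧ (w 7 : ℝ) = 1 :=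
  ⟨rfl, rfl, rfl, rfl, rfl, rfl, rfl, rfl⟩

local notation "Conn" => openDConn src tgt

/-! #### Cylinder bookkeeping -/

/-- The cylinder "all arcs of `F` open". -/
def cyl (F : Finset (Fin 8)) : Set (Set (Fin 8)) := {ω | (↑F : Set (Fin 8)) ⊆ ω}

/-- `P(cyl F) = ∏_{i ∈ F} w i`. -/
private theorem real_cyl (F : Finset (Fin 8)) : (prodBernoulli w).real (cyl F) = ∏ i ∈ F, (w i : ℝ) :=
  prodBernoulli_real_subset w F

/-- Two cylinders intersect in the cylinder of the union. -/
private theorem cyl_inter (F G : Finset (Fin 8)) : cyl F ∩ cyl G = cyl (F ∪ G) := by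
  ext ω; simp [cyl, Set.union_subset_iff]

/-- Inclusion–exclusion for two cylinders. -/
private theorem real_cyl_union (F G : Finset (Fin 8)) :
    (prodBernoulli w).real (cyl F ∪ cyl G) =
      (∏ i ∈ F, (w i : ℝ)) + (∏ i ∈ G, (w i : ℝ)) - ∏ i ∈ F ∪ G, (w i : ℝ) := by
  have h : (prodBernoulli w).real (cyl F ∪ cyl G) + (prodBernoulli w).real (cyl F ∩ cyl G) =
      (prodBernoulli w).real (cyl F) + (prodBernoulli w).real (cyl G) :=
    measureReal_union_add_inter₀ MeasurableSet.of_discrete.nullMeasurableSet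
  rw [cyl_inter, real_cyl, real_cyl, real_cyl] at h
  linarith

/-- Membership in a one-arc cylinder. -/
private theorem mem_cyl_singleton {i : Fin 8} {ω : Set (Fin 8)} : ω ∈ cyl {i} ↔ i ∈ ω := by
  simp [cyl]

/-- Membership in a two-arc cylinder. -/
private theorem mem_cyl_pair {i j : Fin 8} {ω : Set (Fin 8)} : ω ∈ cyl {i, j} ↔ i ∈ ω ∧ j ∈ ω := by
  simp [cyl, Set.insert_subset_iff]

/-- Membership in a three-arc cylinder. -/
private theorem mem_cyl_triple {i j k : Fin 8} {ω : Set (Fin 8)} :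
    ω ∈ cyl {i, j, k} ↔ i ∈ ω ∧ j ∈ ω ∧ k ∈ ω := by
  simp [cyl, Set.insert_subset_iff]

/-! #### Lower bounds on the relay-to-relay connections: explicit open paths -/

/-- `a₁ → a₃ ⊇ {e₂} ∪ {e₄, e₁, e₃}` (directly, or `a₁ → o → a₂ → a₃`). -/
private theorem sub_13 : cyl {2} ∪ cyl {4, 1, 3} ⊆ Conn 1 3 := by
  rintro ω (h | h)
  · exact mem_openDConn_of_mem (e := (2 : Fin 8)) (mem_cyl_singleton.1 h)
  · obtain ⟨h4, h1, h3⟩ := mem_cyl_triple.1 h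
    exact mem_openDConn_tail (e := (3 : Fin 8))
      (mem_openDConn_tail (e := (1 : Fin 8)) (mem_openDConn_of_mem (e := (4 : Fin 8)) h4) h1) h3

/-- `a₂ → a₃ ⊇ {e₃} ∪ {e₅, e₀, e₂}`. -/
private theorem sub_23 : cyl {3} ∪ cyl {5, 0, 2} ⊆ Conn 2 3 := by
  rintro ω (h | h)
  · exact mem_openDConn_of_mem (e := (3 : Fin 8)) (mem_cyl_singleton.1 h)
  · obtain ⟨h5, h0, h2⟩ := mem_cyl_triple.1 h
    exact mem_openDConn_tail (e := (2 : Fin 8))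
      (mem_openDConn_tail (e := (0 : Fin 8)) (mem_openDConn_of_mem (e := (5 : Fin 8)) h5) h0) h2

/-- `a₁ → a₂ ⊇ {e₄, e₁} ∪ {e₂, e₇}` (`a₁ → o → a₂` or `a₁ → a₃ → a₂`). -/
private theorem sub_12 : cyl {4, 1} ∪ cyl {2, 7} ⊆ Conn 1 2 := by
  rintro ω (h | h)
  · obtain ⟨h4, h1⟩ := mem_cyl_pair.1 h
    exact mem_openDConn_tail (e := (1 : Fin 8)) (mem_openDConn_of_mem (e := (4 : Fin 8)) h4) h1
  · obtain ⟨h2, h7⟩ := mem_cyl_pair.1 h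
    exact mem_openDConn_tail (e := (7 : Fin 8)) (mem_openDConn_of_mem (e := (2 : Fin 8)) h2) h7

/-- `a₂ → a₁ ⊇ {e₅, e₀} ∪ {e₃, e₆}`. -/
private theorem sub_21 : cyl {5, 0} ∪ cyl {3, 6} ⊆ Conn 2 1 := by
  rintro ω (h | h)
  · obtain ⟨h5, h0⟩ := mem_cyl_pair.1 h
    exact mem_openDConn_tail (e := (0 : Fin 8)) (mem_openDConn_of_mem (e := (5 : Fin 8)) h5) h0
  · obtain ⟨h3, h6⟩ := mem_cyl_pair.1 h
    exact mem_openDConn_tail (e := (6 : Fin 8)) (mem_openDConn_of_mem (e := (3 : Fin 8)) h3) h6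

/-- `a₃ → a₁ ⊇ {e₆}`. -/
private theorem sub_31 : cyl {6} ⊆ Conn 3 1 := fun _ h =>
  mem_openDConn_of_mem (e := (6 : Fin 8)) (mem_cyl_singleton.1 h)

/-- `a₃ → a₂ ⊇ {e₇}`. -/
private theorem sub_32 : cyl {7} ⊆ Conn 3 2 := fun _ h =>
  mem_openDConn_of_mem (e := (7 : Fin 8)) (mem_cyl_singleton.1 h)

/-- From a sub-event of probability `≥ 1 − 7/250` to `P(complement) ≤ 7/250`. -/
private theorem compl_le_of_sub {E D : Set (Set (Fin 8))} (hDE : D ⊆ E) (hD : 243 / 250 ≤ (prodBernoulli w).real D) :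
    (prodBernoulli w).real Eᶜ ≤ 7 / 250 := by
  have hE : (prodBernoulli w).real D ≤ (prodBernoulli w).real E := measureReal_mono hDE
  have hc : (prodBernoulli w).real Eᶜ = 1 - (prodBernoulli w).real E := by
    rw [measureReal_compl MeasurableSet.of_discrete, probReal_univ]
  rw [hc]; linarith

/-- **Hypothesis of the directed one-cut at `t = 7/250`:** `P(a ↛ a') ≤ 7/250` for all distinct relays. -/
theorem compl_le {a a' : Fin 4} (ha : a ∈ relays) (ha' : a' ∈ relays) (hne : a ≠ a') :
    (prodBernoulli w).real (Conn a a')ᶜ ≤ 7 / 250 := by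
  simp only [relays, Finset.mem_insert, Finset.mem_singleton] at ha ha'
  rcases ha with rfl | rfl | rfl <;> rcases ha' with rfl | rfl | rfl
  · exact absurd rfl hne
  · refine compl_le_of_sub sub_12 ?_
    rw [real_cyl_union]; simp [Finset.prod_insert, Finset.prod_singleton]; norm_num
  · refine compl_le_of_sub sub_13 ?_
    rw [real_cyl_union]; simp [Finset.prod_insert, Finset.prod_singleton]; norm_num
  · refine compl_le_of_sub sub_21 ?_
    rw [real_cyl_union]; simp [Finset.prod_insert, Finset.prod_singleton]; norm_num
  · exact absurd rfl hne
  · refine compl_le_of_sub sub_23 ?_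
    rw [real_cyl_union]; simp [Finset.prod_insert, Finset.prod_singleton]; norm_num
  · refine compl_le_of_sub sub_31 ?_
    rw [real_cyl]; norm_num
  · refine compl_le_of_sub sub_32 ?_
    rw [real_cyl]; norm_num
  · exact absurd rfl hne

/-! #### Lower bounds on `P(o → a)`: the sum exceeds `2` -/

/-- `P(o → a₁) ≥ q = 4/5` (arc `e₀`). -/
private theorem real_o1_ge : 4 / 5 ≤ (prodBernoulli w).real (Conn 0 1) := by
  have h : cyl {0} ⊆ Conn 0 1 := fun ω hω => mem_openDConn_of_mem (e := (0 : Fin 8)) (mem_cyl_singleton.1 hω)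
  have hm : (prodBernoulli w).real (cyl {0}) ≤ (prodBernoulli w).real (Conn 0 1) := measureReal_mono h
  rw [real_cyl] at hm; norm_num at hm; exact hm

/-- `P(o → a₂) ≥ q = 4/5` (arc `e₁`). -/
private theorem real_o2_ge : 4 / 5 ≤ (prodBernoulli w).real (Conn 0 2) := by
  have h : cyl {1} ⊆ Conn 0 2 := fun ω hω => mem_openDConn_of_mem (e := (1 : Fin 8)) (mem_cyl_singleton.1 hω)
  have hm : (prodBernoulli w).real (cyl {1}) ≤ (prodBernoulli w).real (Conn 0 2) := measureReal_mono h
  rw [real_cyl] at hm; norm_num at hm; exact hm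

/-- `P(o → a₃) ≥ qr = 18/25` (arcs `e₀, e₂`). -/
private theorem real_o3_ge : 18 / 25 ≤ (prodBernoulli w).real (Conn 0 3) := by
  have h : cyl {0, 2} ⊆ Conn 0 3 := fun ω hω => by
    obtain ⟨h0, h2⟩ := mem_cyl_pair.1 hω
    exact mem_openDConn_tail (e := (2 : Fin 8)) (mem_openDConn_of_mem (e := (0 : Fin 8)) h0) h2
  have hm : (prodBernoulli w).real (cyl {0, 2}) ≤ (prodBernoulli w).real (Conn 0 3) := measureReal_mono h
  rw [real_cyl] at hm
  simp [Finset.prod_insert, Finset.prod_singleton] at hm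
  norm_num at hm; exact hm

/-- `Σ_{a ∈ A} P(o → a) ≥ 58/25 > 2`. -/
theorem sum_real_ge : 58 / 25 ≤ ∑ a ∈ relays, (prodBernoulli w).real (Conn 0 a) := by
  rw [show relays = {1, 2, 3} from rfl, Finset.sum_insert (by decide), Finset.sum_insert (by decide),
    Finset.sum_singleton]
  linarith [real_o1_ge, real_o2_ge, real_o3_ge]

/-! #### The two witnessing cylinders: exactly one relay reached -/

/-- `D₁ = {e₀ open, e₁ closed, e₂ closed}`: `o` reaches `a₁` only. -/
def D₁ : Set (Set (Fin 8)) := {ω | (0 : Fin 8) ∈ ω ∧ (1 : Fin 8) ∉ ω ∧ (2 : Fin 8) ∉ ω}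

/-- `D₂ = {e₁ open, e₀ closed, e₃ closed}`: `o` reaches `a₂` only. -/
def D₂ : Set (Set (Fin 8)) := {ω | (1 : Fin 8) ∈ ω ∧ (0 : Fin 8) ∉ ω ∧ (3 : Fin 8) ∉ ω}

/-- On `D₁` the set of vertices reachable from `o` is contained in `{o, a₁}` (closure principle). -/
private theorem reach_D₁ {ω : Set (Fin 8)} (hω : ω ∈ D₁) {y : Fin 4} (hy : ω ∈ Conn 0 y) : y = 0 ∨ y = 1 := by
  obtain ⟨_, h1, h2⟩ := hω
  have := mem_of_closed (src := src) (tgt := tgt) ({v : Fin 4 | v = 0 ∨ v = 1}) (by simp) ?_ hy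
  · simpa using this
  intro e he hsrc
  fin_cases e <;> simp_all

/-- On `D₂` the set of vertices reachable from `o` is contained in `{o, a₂}` (closure principle). -/
private theorem reach_D₂ {ω : Set (Fin 8)} (hω : ω ∈ D₂) {y : Fin 4} (hy : ω ∈ Conn 0 y) : y = 0 ∨ y = 2 := by
  obtain ⟨_, h0, h3⟩ := hω
  have := mem_of_closed (src := src) (tgt := tgt) ({v : Fin 4 | v = 0 ∨ v = 2}) (by simp) ?_ hy
  · simpa using this
  intro e he hsrc
  fin_cases e <;> simp_all

/-- On `D₁` exactly the relay `a₁` is reached from `o`. -/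
private theorem filter_D₁ {ω : Set (Fin 8)} (hω : ω ∈ D₁) :
    (relays.filter fun a => ω ∈ Conn 0 a) = {1} := by
  ext a
  simp only [relays, Finset.mem_filter, Finset.mem_insert, Finset.mem_singleton]
  constructor
  · rintro ⟨ha, hconn⟩
    rcases reach_D₁ hω hconn with h | h
    · rcases ha with rfl | rfl | rfl <;> simp at h
    · exact h
  · rintro rfl
    exact ⟨by simp, mem_openDConn_of_mem (e := (0 : Fin 8)) hω.1⟩

/-- On `D₂` exactly the relay `a₂` is reached from `o`. -/
private theorem filter_D₂ {ω : Set (Fin 8)} (hω : ω ∈ D₂) :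
    (relays.filter fun a => ω ∈ Conn 0 a) = {2} := by
  ext a
  simp only [relays, Finset.mem_filter, Finset.mem_insert, Finset.mem_singleton]
  constructor
  · rintro ⟨ha, hconn⟩
    rcases reach_D₂ hω hconn with h | h
    · rcases ha with rfl | rfl | rfl <;> simp at h
    · exact h
  · rintro rfl
    exact ⟨by simp, mem_openDConn_of_mem (e := (1 : Fin 8)) hω.1⟩

/-- The lower-tail event of the one-cut statement. -/
def lowerTail : Set (Set (Fin 8)) :=
  {ω | 1 ≤ (relays.filter fun a => ω ∈ Conn 0 a).card ∧
    ((relays.filter fun a => ω ∈ Conn 0 a).card : ℝ) < (∑ a ∈ relays, (prodBernoulli w).real (Conn 0 a)) / 2}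

/-- Both witnessing cylinders lie in the lower-tail event (`N = 1 < Σ/2` since `Σ ≥ 58/25 > 2`). -/
private theorem D_subset : D₁ ∪ D₂ ⊆ lowerTail := by
  rintro ω (hω | hω)
  · refine ⟨by rw [filter_D₁ hω]; simp, ?_⟩
    rw [filter_D₁ hω]; simp; linarith [sum_real_ge]
  · refine ⟨by rw [filter_D₂ hω]; simp, ?_⟩
    rw [filter_D₂ hω]; simp; linarith [sum_real_ge]

/-- `P(D₁) = q(1−q)(1−r) = 2/125`: `D₁ = cyl{e₀} ∖ (cyl{e₀,e₁} ∪ cyl{e₀,e₂})`. -/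
private theorem real_D₁ : (prodBernoulli w).real D₁ = 2 / 125 := by
  have hset : D₁ = cyl {0} \ (cyl {0, 1} ∪ cyl {0, 2}) := by
    ext ω; simp only [D₁, cyl, mem_setOf_eq, mem_sdiff, mem_union, Finset.coe_insert, Finset.coe_singleton,
      Set.insert_subset_iff, Set.singleton_subset_iff]; tauto
  have hsub : cyl {0, 1} ∪ cyl {0, 2} ⊆ cyl ({0} : Finset (Fin 8)) := by
    rintro ω (h | h)
    · exact mem_cyl_singleton.2 (mem_cyl_pair.1 h).1
    · exact mem_cyl_singleton.2 (mem_cyl_pair.1 h).1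
  rw [hset, measureReal_sdiff hsub MeasurableSet.of_discrete, real_cyl, real_cyl_union]
  simp [Finset.prod_insert, Finset.prod_singleton]
  norm_num

/-- `P(D₂) = q(1−q)(1−r) = 2/125`: `D₂ = cyl{e₁} ∖ (cyl{e₁,e₀} ∪ cyl{e₁,e₃})`. -/
private theorem real_D₂ : (prodBernoulli w).real D₂ = 2 / 125 := by
  have hset : D₂ = cyl {1} \ (cyl {1, 0} ∪ cyl {1, 3}) := by
    ext ω; simp only [D₂, cyl, mem_setOf_eq, mem_sdiff, mem_union, Finset.coe_insert, Finset.coe_singleton,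
      Set.insert_subset_iff, Set.singleton_subset_iff]; tauto
  have hsub : cyl {1, 0} ∪ cyl {1, 3} ⊆ cyl ({1} : Finset (Fin 8)) := by
    rintro ω (h | h)
    · exact mem_cyl_singleton.2 (mem_cyl_pair.1 h).1
    · exact mem_cyl_singleton.2 (mem_cyl_pair.1 h).1
  rw [hset, measureReal_sdiff hsub MeasurableSet.of_discrete, real_cyl, real_cyl_union]
  simp [Finset.prod_insert, Finset.prod_singleton]
  norm_num

/-- `D₁` and `D₂` are disjoint (`e₀` open vs closed). -/
private theorem disjoint_D : Disjoint D₁ D₂ := by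
  rw [Set.disjoint_left]
  rintro ω ⟨h0, -, -⟩ ⟨-, h0', -⟩
  exact h0' h0

/-- **The lower tail is heavy:** `P(1 ≤ N ∧ N < Σ/2) ≥ P(D₁) + P(D₂) = 4/125`. -/
theorem lowerTail_ge : 4 / 125 ≤ (prodBernoulli w).real lowerTail := by
  have hu : (prodBernoulli w).real (D₁ ∪ D₂) = 4 / 125 := by
    rw [measureReal_union disjoint_D MeasurableSet.of_discrete, real_D₁, real_D₂]; norm_num
  rw [← hu]
  exact measureReal_mono D_subset

end DirectedOneCutCex

/-- **The directed analogue of the ONE-CUT sharp form is false.**  With a finite digraph (`Fin m` arcs on `Fin n`,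
endpoints `src, tgt`, independent arcs of weights `w`), directed connection `openDConn` in place of `openConn`
and the slack `t` bounding `P(a ↛ a')` over all ordered pairs of distinct relays, the statement
"`P(1 ≤ N ∧ N < (Σ_a P(o → a))/2) ≤ t`" FAILS: the four-vertex digraph above with `t = 7/250` has all
`P(a ↛ a') ≤ 7/250` but lower tail `≥ 4/125 = 8/250`.  (Census verdict ttrl2 cp-lit3, `ttrl/dircut/README.md`;
closed form: violation iff `2q(1−q) > 1 − qr` with `Σ > 2`.) -/
theorem not_directedOneCut :
    ¬ ∀ (n m : ℕ) (src tgt : Fin m → Fin n) (w : Fin m → unitInterval) (A : Finset (Fin n)) (o : Fin n) (t : ℝ),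
        0 ≤ t →
        (∀ a ∈ A, ∀ a' ∈ A, a ≠ a' → (prodBernoulli w).real (openDConn src tgt a a')ᶜ ≤ t) →
          (prodBernoulli w).real {ω : Set (Fin m) | 1 ≤ (A.filter fun a => ω ∈ openDConn src tgt o a).card ∧
              ((A.filter fun a => ω ∈ openDConn src tgt o a).card : ℝ) <
                (∑ a ∈ A, (prodBernoulli w).real (openDConn src tgt o a)) / 2} ≤ t := by
  intro h
  have key := h 4 8 DirectedOneCutCex.src DirectedOneCutCex.tgt DirectedOneCutCex.w DirectedOneCutCex.relays 0
    (7 / 250) (by norm_num) (fun a ha a' ha' hne => DirectedOneCutCex.compl_le ha ha' hne)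
  have low := DirectedOneCutCex.lowerTail_ge
  unfold DirectedOneCutCex.lowerTail at low
  linarith

end Summit.CriticalPhenomena.PercolationContinuityZ3.Theorems
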